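import Summits.RiemannHypothesis.RiemannHypothesis.Theses.LeeYang

/-!
# Strategist sketch — crux `LeeYang.LeeyangNeg` (stmt-RiemannHypothesis-0457), 2026-08-17

First-lemma signatures for the strategist's census / crux ideas (all over existing declarations):

* `FiniteResolutionSufficiency` — lens STRENGTHEN: the finite-resolution exclusion form
  `W′(Θ, B, M, ε)` (a statement about EXACT finite ferromagnets only, no limits, no RH) implies the
  crux.  True (soft: weak convergence tested against the bounded continuous functions `cos(θ·)`,
  `min(e^{bu²}, M)`); it is the `stub_reduce` of any certified-computation line.
* `watkins_noVerticalAPZeros` — Literature fact to vendor (Lapidus–van Frankenhuijsen 2006,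
  Thm 11.23 = Watkins / van Frankenhuijsen–Watkins; Thm 11.1 = Putnam 1954): no infinite vertical
  arithmetic progression `ω + 2πikp`, `k ∈ ℤ ∖ {0}`, of zeros of `ζ` with `Re ω ≥ 1/2`, `p ≥ 1/log 4`.
* `FreeSpinExclusion` — lens NEGATION, rung 1 of the architecture-exclusion ladder: `ν_Φ` is not an
  Ising limit law along any witness sequence with `J ≡ 0` (free spins / symmetric Bernoulli
  convolutions).  TWO proofs.  (A, elementary + certified low zeros, all tools in tree): free-spin
  transforms are cosine products `∏ cos(wᵢθ)` whose zero set is the UNION OF THE LATTICES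
  `(π/wᵢ)(ℤ+½)`; weak convergence + bounded variance ⇒ uniform convergence of ch.f.s on compacts;
  `φ_Φ = ξ(½+iθ/2)/ξ(½)` changes sign at `x₁ = 2γ₀ ∈ [28.12, 28.38]` (N(14)=0, N(16)=1:
  `zetaZeroCount_fourteen/_sixteen`) so `φ_k` has a zero `θ*_k → x₁`, a lattice point of index `m_k`
  of some weight; `m_k ≥ 1` would put a lattice point (spacing ≤ 2θ*_k/3 < 19) inside `[1, 20]` where
  `|φ_Φ| ≥ c > 0` (`riemannZeta_ne_zero_of_im_pos_of_im_le_fourteen`) — impossible for large k; so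
  `m_k = 0` and `3θ*_k` is a zero of `φ_k` with `3θ*_k → 3x₁ = 6γ₀ ∈ [84.4, 85.2]`, forcing
  `ξ(½ + 3iγ₀) = 0`, i.e. a zeta zero with ordinate in `[42.19, 42.57]` — excluded by
  `noZetaZero_ordinate_42_43` below (N(42) = N(43) = 7: zeros at 40.92 and 43.33; certifiable with the
  tree's `ZetaZeroCountCertificate` machinery exactly like `zetaZeroCount_sixteen`).  (B, conceptual):
  the largest weight converges to `a₁ > 0`, `|φ_k| ≤ |cos(a₁^{(k)}θ)|` pins the whole lattice
  `(π/a₁)(ℤ+½)` of zeros on ξ, contradicting `watkins_noVerticalAPZeros` (LvF Thm 11.23; the tree's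
  `LapidusVanFrankenhuijsen2006_thm11_1` is the unshifted case and does not apply to odd multiples).
* `SechSmoothedXiNoLattice` — rung 2 target (stars over free spins = the `coshTilt` class of the
  standing witness `ν_h`): the cosine transform of `Φ(u)/cosh(hu)` vanishes on no lattice
  `(π/a)(ℕ + ½)`.  Open; RH-free; LvF-type explicit-formula methods are the candidate tool.
-/

noncomputable section

set_option linter.dupNamespace false

open MeasureTheory Filter Topology

namespace Summit.RiemannHypothesis.RiemannHypothesis.Cruxes.LeeyangNeg.Strategist

open Literature.Probability.LatticeModels Literature.NumberTheory.LFunctions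

/-- The normalised de Bruijn law `ν_Φ` (as a predicate on probability measures, exactly as in the
crux). -/
def IsDeBruijnLaw (ν : ProbabilityMeasure ℝ) : Prop :=
  (ν : Measure ℝ) = (∫⁻ u, ENNReal.ofReal (deBruijnPhi u))⁻¹ •
    volume.withDensity (fun u => ENNReal.ofReal (deBruijnPhi u))

/-- **Finite-resolution sufficiency (lens: strengthen).** If, for some finite grid `Θ` of
frequencies, finite set `B` of Gaussian-moment orders, truncation level `M` and tolerance
`ε > 0`, EVERY exact finite ferromagnet magnetisation law obeying `ν_Φ`'s own truncated moment
budget misses `ν_Φ`'s characteristic function `ξ(½ + iθ/2)/ξ(½) = ∫cos(θu)Φ/∫Φ` by at least `ε`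
at some grid frequency, then `ν_Φ` is not an Ising limit law.  (Weak convergence tested against
the bounded continuous functions `u ↦ cos(θu)` and `u ↦ min(e^{bu²}, M)`.) -/
def FiniteResolutionSufficiency : Prop :=
  ∀ (Θ B : Finset ℝ) (M ε : ℝ), 0 < ε →
    (∀ (n : ℕ) (J : Fin n → Fin n → ℝ) (w : Fin n → ℝ), (∀ i j, 0 ≤ J i j) → (∀ i, 0 ≤ w i) →
      (∀ b ∈ B, ∫ u, min (Real.exp (b * u ^ 2)) M ∂(isingMagnetizationLaw n J w : Measure ℝ) ≤
          2 * ((∫ u, Real.exp (b * u ^ 2) * deBruijnPhi u) / ∫ u, deBruijnPhi u)) →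
      ∃ θ ∈ Θ, ε ≤ |(∫ u, Real.cos (θ * u) ∂(isingMagnetizationLaw n J w : Measure ℝ)) -
          (∫ u, Real.cos (θ * u) * deBruijnPhi u) / ∫ u, deBruijnPhi u|) →
    Summit.RiemannHypothesis.RiemannHypothesis.Theses.LeeYang.LeeyangNeg

/-- **Watkins / van Frankenhuijsen–Watkins; Putnam** (Lapidus–van Frankenhuijsen, *Fractal
Geometry, Complex Dimensions and Zeta Functions*, Springer 2006, Thm 11.23 and Thm 11.1):
`ζ` has no infinite vertical arithmetic progression of zeros `ω + 2πikp` (`k ∈ ℤ ∖ {0}`) with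
`Re ω ≥ 1/2` and `p ≥ 1/log 4` (the printed theorem even bounds the first non-zero `k`). To be
vendored as a named Literature fact. -/
def watkins_noVerticalAPZeros : Prop :=
  ∀ (ω : ℂ) (p : ℝ), 1 / 2 ≤ ω.re → 1 / Real.log 4 ≤ p →
    ∃ k : ℤ, k ≠ 0 ∧ riemannZeta (ω + 2 * Real.pi * Complex.I * k * p) ≠ 0

/-- Numerical input of proof (A) of rung 1: no zero of `ζ` has ordinate in `[42, 43]`
(`N(42) = N(43) = 7`; the neighbouring zeros are `40.9187…` and `43.3270…`). Certifiable in tree with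
`ZetaZeroCountCertificate.zetaZeroCount_eq_of_hpieces_stirling` (as `zetaZeroCount_sixteen`). -/
def noZetaZero_ordinate_42_43 : Prop :=
  ∀ s : ℂ, 42 ≤ s.im → s.im ≤ 43 → riemannZeta s ≠ 0

/-- **Free-spin exclusion (lens: negation; ladder rung 1).** The de Bruijn law is not an Ising
limit law along any witness sequence with identically ZERO couplings (laws of `Σ wᵢ εᵢ` with
independent fair signs), whatever the weights and however the `e^{bu²}`-moments are bounded. -/
def FreeSpinExclusion : Prop :=
  ∀ ν : ProbabilityMeasure ℝ, IsDeBruijnLaw ν →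
    ∀ (n : ℕ → ℕ) (w : ∀ k, Fin (n k) → ℝ), (∀ k i, 0 ≤ w k i) →
      (∀ b : ℝ, ∃ C : ℝ, ∀ k,
          ∫ u, Real.exp (b * u ^ 2) ∂(isingMagnetizationLaw (n k) (fun _ _ => 0) (w k) : Measure ℝ) ≤ C) →
      ¬ Tendsto (fun k => isingMagnetizationLaw (n k) (fun _ _ => 0) (w k)) atTop (𝓝 ν)

/-- **Rung-2 target (stars over free spins).** For every hub field `h > 0` and lattice scale
`a > 0`, the cosine transform of `Φ(u) sech(hu)` does not vanish at every point of the lattice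
`(π/a)(ℕ + ½)` — i.e. `Φ du/∫Φ` is not `cosh(hu)·BC(a)(du)/Z` for a symmetric Bernoulli convolution
with top weight `a`. -/
def SechSmoothedXiNoLattice : Prop :=
  ∀ (h a : ℝ), 0 < h → 0 < a →
    ∃ m : ℕ, (∫ u, Real.cos (Real.pi / a * ((m : ℝ) + 1 / 2) * u) * (deBruijnPhi u / Real.cosh (h * u))) ≠ 0

/-- Sanity composition: rung 1 is an instance of the crux's conclusion restricted to `J ≡ 0`
witnesses — the crux itself implies it (so it is genuinely WEAKER, not a costume). -/
theorem freeSpinExclusion_of_leeyangNeg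
    (h : Summit.RiemannHypothesis.RiemannHypothesis.Theses.LeeYang.LeeyangNeg) :
    FreeSpinExclusion := by
  intro ν hν n w hw hmom hlim
  refine h ν hν ⟨n, fun k _ _ => 0, w, fun _ _ _ => le_rfl, hw, hlim, hmom⟩

end Summit.RiemannHypothesis.RiemannHypothesis.Cruxes.LeeyangNeg.Strategist

end
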